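import Literature.NumberTheory.ComplexMultiplication.CMOrderIdealGeneratorsMaximalOrderBoundGeneral
import HarnessLib

/-!
# MARSEGLIA 2024 THEOREM 4.7 completed: (ii), (iv) and (v) versus (vi) — the maxima over ALL over-orders

Family `hodge`, lane `lit-hodgefound` (Track 2 foundations library; seat p15, row g31-#1), topic
`Literature/NumberTheory/ComplexMultiplication`, namespace `Literature.NumberTheory.ComplexMultiplication.CMTypeLattice`
(the orders `S = endOrder (M_μ)` of a number field `K`, `μ` a `ℚ`-basis; over-orders are PRESENTED as
`T = endOrder (M_ν) ⊇ S`; the maximal order is a fractional ideal `M` with `↑M = range (algebraMap (𝓞 K) K)`;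
`gens_S(I) = Submodule.spanFinrank ↑I`, `gens(S) = ⨆_{I ≠ 0} gens_S(I)`; `dim_{T/𝔔} J/𝔔J` is
`Module.finrank (T ⧸ 𝔔) (↥↑J ⧸ 𝔔 • ⊤)`; the multiplicator ring `(𝔔:𝔔)` is the fractional ideal `↑𝔔 / ↑𝔔`).
THEOREMS ONLY: no definition, no instance, no notation, no named fact (net Literature debt `0`).

## Source, VERBATIM

S. Marseglia, *Cohen-Macaulay type of orders, generators and ideal classes*, J. Algebra 658 (2024) 247–276
[Marseglia2024CMType] (held `paper:arxiv-2206.03758`), §4, chunk p0011: "Theorem 4.7. Let `S` be a non-maximal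
order, `𝒮` be the set of overorders `T` of `S`, and `d` be a positive integer. Then the following are equivalent:
(i) `1 + max_{T ∈ 𝒮} type(T) = d`. (ii) `max_{T ∈ 𝒮} max{dim_{T/𝔓} ((𝔓:𝔓)/𝔓(𝔓:𝔓)) : 𝔓 a prime of T} = d`.
(iii) `gens_S(𝒪_K/S) = d − 1`. (iv) `max_{T ∈ 𝒮} max{dim_{T/𝔓} (𝒪_K/𝔓𝒪_K) : 𝔓 a prime of T} = d`.
(v) `max_{T ∈ 𝒮} gens(T) = d`. (vi) `gens(S) = d`.  Proof. Let `T` be a non-maximal overorder in `𝒮`. Then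
`type(T) + 1 = max{dim_{T/𝔓} (𝔓:𝔓)/𝔓(𝔓:𝔓) : 𝔓 a prime of T}`, by Corollary 3.6. This implies the equivalence
of (i) and (ii). Corollary 4.4 gives the equivalence of (iii) and (iv). Note that for every `T ∈ 𝒮`, every
fractional `T`-ideal `I` is also a fractional `S`-ideal. So we have `gens_T(I) ≤ gens_S(I)`. Hence
`gens(S) = max_{T ∈ 𝒮} gens(T)`. In particular, (iv) and (v) are equivalent. […]"; §3, chunk p0009: "Corollary 3.6.
Let `S` be a non-maximal order. Then `type(S) + 1 = max{dim_{S/𝔭} (𝔭:𝔭)/𝔭(𝔭:𝔭) : 𝔭 is a prime of S}`."; §4,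
chunk p0010: "Corollary 4.4. Let `S` be a non-maximal order. Then
`gens(S) = gens_S(𝒪_K) = max{dim_{S/𝔭}(𝒪_K/𝔭𝒪_K) : 𝔭 prime of S}`."

## What the tree already has, and what this file adds

THEOREM 4.7 (i) ⟺ (iii) ⟺ (vi) hold for EVERY non-maximal order `S = endOrder (M_μ)`
(`CMOrderIdealGeneratorsMaximalOrderBoundGeneral`: `forall_le_and_exists_eq_iSup_spanFinrank`,
`iSup_spanFinrank_coe_eq_spanFinrank_top_quotient_add_one`, `iSup_spanFinrank_coe_eq_iSup_finrank_quotient_smul_top`),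
«`gens(T) ≤ gens(S)`» is `CMOrderGeneratorsOverordersType.iSup_spanFinrank_coe_le_iSup_spanFinrank_coe_of_le`,
COROLLARY 3.6 with equation (4.3) is `CMOrderCohenMacaulayTypeGenerators.iSup_finrank_traceDual_quotient_add_one_eq_iSup_spanFinrank`
and the over-order `T = S + 𝔭𝒪_K` is presented by `CMOrderMaximalOrderQuotientDimension.exists_basis_mem_endOrder_iff_exists_add`.
The three remaining items compare `gens(S)` with a MAXIMUM OVER ALL OVER-ORDERS `T ∈ 𝒮`; since `𝒮` is met here
through its presentations `T = endOrder (M_ν)`, `S ≤ T`, each «`max_{T ∈ 𝒮} q(T) = gens(S)`» is stated as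
«`q(T) ≤ gens(S)` for every over-order, with equality for some over-order», and, for (v), also as a `⨆` over
the subtype of presentations `{ν // S ≤ endOrder (M_ν)}` (the multiplicator rings `(𝔔:𝔔)` of (ii) are quotients of
fractional ideals, which Mathlib forms under `[IsFractionRing T K]`; that instance — always available as
`isFractionRing_endOrder` — is bound inside the quantifiers):

* §1 `finrank_quotient_smul_top_le_iSup_spanFinrank`, `iSup_finrank_quotient_smul_top_le_iSup_spanFinrank`
  (`max_𝔭 dim_{S/𝔭} J/𝔭J ≤ gens_S(J) ≤ gens(S)` for every `J ≠ 0`, LEMMA 4.2's easy direction) and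
  `iSup_finrank_div_self_quotient_le_iSup_spanFinrank` (`max_𝔭 dim (𝔭:𝔭)/𝔭(𝔭:𝔭) ≤ gens(S)`, also for `S = 𝒪_K`).
* §2 (v) ⟺ (vi): **`forall_iSup_spanFinrank_coe_le_and_exists_eq`**, `iSup_iSup_spanFinrank_coe_eq`
  (`gens(S) = max_{T ∈ 𝒮} gens(T)`).
* §3 (iv) ⟺ (vi): **`forall_iSup_finrank_quotient_smul_top_le_and_exists_eq`**
  (`gens(S) = max_{T ∈ 𝒮} max_𝔔 dim_{T/𝔔} 𝒪_K/𝔔𝒪_K`, the maximum attained at `T = S`, COROLLARY 4.4).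
* §4 (ii) ⟺ (vi): **`forall_iSup_finrank_div_self_quotient_le_and_exists_eq`**
  (`gens(S) = max_{T ∈ 𝒮} max_𝔔 dim_{T/𝔔} (𝔔:𝔔)/𝔔(𝔔:𝔔)`, the maximum attained at the over-order
  `T = S + 𝔭𝒪_K` of PROPOSITION 4.5 through COROLLARY 3.6; at `T = 𝒪_K` the inner maximum is `1`,
  `CMOrderCohenMacaulayTypeGlobal.iSup_finrank_div_self_quotient_eq_one_of_forall_mem`, which is why the printed
  proof restricts COROLLARY 3.6 to the non-maximal `T`).
-/

noncomputable section

open scoped nonZeroDivisors NumberField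
open NumberField Module FractionalIdeal
open Submodule (traceDual)

namespace Literature.NumberTheory.ComplexMultiplication

namespace CMTypeLattice

section OverordersMaxima

variable {K : Type} [Field K] [NumberField K]
variable {ι : Type} [Fintype ι] [DecidableEq ι] (μ : Basis ι ℚ K) [Nonempty ι]

/-! ## §1 Local dimensions are bounded by `gens(S)` -/

/-- **`dim_{S/𝔭} J/𝔭J ≤ gens_S(J) ≤ gens(S)`** for every fractional ideal `J ≠ 0` and every prime `𝔭` (LEMMA 4.2,
the direction «the global number of generators bounds every local dimension», and DEFINITION 4.1).
[cite: Marseglia2024CMType, §4 Lemma 4.2 and Def. 4.1, p. 10] -/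
theorem finrank_quotient_smul_top_le_iSup_spanFinrank
    {J : FractionalIdeal (endOrder (Algebra.leftMulMatrix μ))⁰ K} (hJ : J ≠ 0)
    (𝔭 : MaximalSpectrum (endOrder (Algebra.leftMulMatrix μ))) :
    Module.finrank (endOrder (Algebra.leftMulMatrix μ) ⧸ 𝔭.asIdeal)
        ((J : Submodule (endOrder (Algebra.leftMulMatrix μ)) K) ⧸
          (𝔭.asIdeal • ⊤ : Submodule (endOrder (Algebra.leftMulMatrix μ))
            (J : Submodule (endOrder (Algebra.leftMulMatrix μ)) K))) ≤
      ⨆ I : {I : FractionalIdeal (endOrder (Algebra.leftMulMatrix μ))⁰ K // I ≠ 0},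
        ((I : FractionalIdeal (endOrder (Algebra.leftMulMatrix μ))⁰ K) :
          Submodule (endOrder (Algebra.leftMulMatrix μ)) K).spanFinrank := by
  haveI := isFractionRing_endOrder (Algebra.leftMulMatrix μ)
  haveI := 𝔭.isMaximal
  exact (EndOrder.finrank_quotient_smul_top_le_spanFinrank J (asIdeal_ne_bot μ 𝔭)).trans
    (spanFinrank_coe_le_iSup μ hJ)

/-- **`max_𝔭 dim_{S/𝔭} J/𝔭J ≤ gens(S)`** for every fractional ideal `J ≠ 0`. [cite: Marseglia2024CMType, §4 Lemma 4.2
and Def. 4.1, p. 10] -/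
theorem iSup_finrank_quotient_smul_top_le_iSup_spanFinrank
    {J : FractionalIdeal (endOrder (Algebra.leftMulMatrix μ))⁰ K} (hJ : J ≠ 0) :
    ⨆ 𝔭 : MaximalSpectrum (endOrder (Algebra.leftMulMatrix μ)),
        Module.finrank (endOrder (Algebra.leftMulMatrix μ) ⧸ 𝔭.asIdeal)
          ((J : Submodule (endOrder (Algebra.leftMulMatrix μ)) K) ⧸
            (𝔭.asIdeal • ⊤ : Submodule (endOrder (Algebra.leftMulMatrix μ))
              (J : Submodule (endOrder (Algebra.leftMulMatrix μ)) K))) ≤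
      ⨆ I : {I : FractionalIdeal (endOrder (Algebra.leftMulMatrix μ))⁰ K // I ≠ 0},
        ((I : FractionalIdeal (endOrder (Algebra.leftMulMatrix μ))⁰ K) :
          Submodule (endOrder (Algebra.leftMulMatrix μ)) K).spanFinrank := by
  haveI := nonempty_maximalSpectrum μ
  exact ciSup_le fun 𝔭 ↦ finrank_quotient_smul_top_le_iSup_spanFinrank μ hJ 𝔭

/-- **`max_𝔭 dim_{S/𝔭} (𝔭:𝔭)/𝔭(𝔭:𝔭) ≤ gens(S)`** for every order `S = endOrder (M_μ)` — «`dim_{T/𝔓} (𝔓:𝔓)/𝔓(𝔓:𝔓) =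
gens_T((𝔓:𝔓))` […] which is bounded from above by `gens(T)`» (for the maximal order the left side is `1`).
[cite: Marseglia2024CMType, §4 Thm. 4.7 (proof, eq. (4.3)), p. 11] -/
theorem iSup_finrank_div_self_quotient_le_iSup_spanFinrank [IsFractionRing (endOrder (Algebra.leftMulMatrix μ)) K] :
    ⨆ 𝔭 : MaximalSpectrum (endOrder (Algebra.leftMulMatrix μ)),
        Module.finrank (endOrder (Algebra.leftMulMatrix μ) ⧸ 𝔭.asIdeal)
          ((((𝔭.asIdeal : FractionalIdeal (endOrder (Algebra.leftMulMatrix μ))⁰ K) / 𝔭.asIdeal :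
            FractionalIdeal (endOrder (Algebra.leftMulMatrix μ))⁰ K) : Submodule (endOrder (Algebra.leftMulMatrix μ)) K) ⧸
            (𝔭.asIdeal • ⊤ : Submodule (endOrder (Algebra.leftMulMatrix μ))
              (((𝔭.asIdeal : FractionalIdeal (endOrder (Algebra.leftMulMatrix μ))⁰ K) / 𝔭.asIdeal :
                FractionalIdeal (endOrder (Algebra.leftMulMatrix μ))⁰ K) :
                  Submodule (endOrder (Algebra.leftMulMatrix μ)) K))) ≤
      ⨆ I : {I : FractionalIdeal (endOrder (Algebra.leftMulMatrix μ))⁰ K // I ≠ 0},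
        ((I : FractionalIdeal (endOrder (Algebra.leftMulMatrix μ))⁰ K) :
          Submodule (endOrder (Algebra.leftMulMatrix μ)) K).spanFinrank := by
  haveI := nonempty_maximalSpectrum μ
  exact ciSup_le fun 𝔭 ↦ finrank_quotient_smul_top_le_iSup_spanFinrank μ
    (EndOrder.div_self_ne_zero (coeIdeal_ne_zero.2 (asIdeal_ne_bot μ 𝔭))) 𝔭

/-! ## §2 THEOREM 4.7 (v) ⟺ (vi): `gens(S) = max_{T ∈ 𝒮} gens(T)` -/

/-- **MARSEGLIA 2024 THEOREM 4.7, (v) ⟺ (vi) «`max_{T ∈ 𝒮} gens(T) = d` ⟺ `gens(S) = d`»**: `gens(T) ≤ gens(S)` for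
every over-order `T = endOrder (M_ν) ⊇ S` («every fractional `T`-ideal `I` is also a fractional `S`-ideal. So we
have `gens_T(I) ≤ gens_S(I)`. Hence `gens(S) = max_{T ∈ 𝒮} gens(T)`»), with equality at `T = S ∈ 𝒮`.
[cite: Marseglia2024CMType, §4 Thm. 4.7 ((v) ⟺ (vi)) and proof, p. 11] -/
theorem forall_iSup_spanFinrank_coe_le_and_exists_eq :
    (∀ ν : Basis ι ℚ K, endOrder (Algebra.leftMulMatrix μ) ≤ endOrder (Algebra.leftMulMatrix ν) →
      ⨆ I' : {I' : FractionalIdeal (endOrder (Algebra.leftMulMatrix ν))⁰ K // I' ≠ 0},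
          ((I' : FractionalIdeal (endOrder (Algebra.leftMulMatrix ν))⁰ K) :
            Submodule (endOrder (Algebra.leftMulMatrix ν)) K).spanFinrank ≤
        ⨆ I : {I : FractionalIdeal (endOrder (Algebra.leftMulMatrix μ))⁰ K // I ≠ 0},
          ((I : FractionalIdeal (endOrder (Algebra.leftMulMatrix μ))⁰ K) :
            Submodule (endOrder (Algebra.leftMulMatrix μ)) K).spanFinrank) ∧
    ∃ ν : Basis ι ℚ K, endOrder (Algebra.leftMulMatrix μ) ≤ endOrder (Algebra.leftMulMatrix ν) ∧
      ⨆ I' : {I' : FractionalIdeal (endOrder (Algebra.leftMulMatrix ν))⁰ K // I' ≠ 0},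
          ((I' : FractionalIdeal (endOrder (Algebra.leftMulMatrix ν))⁰ K) :
            Submodule (endOrder (Algebra.leftMulMatrix ν)) K).spanFinrank =
        ⨆ I : {I : FractionalIdeal (endOrder (Algebra.leftMulMatrix μ))⁰ K // I ≠ 0},
          ((I : FractionalIdeal (endOrder (Algebra.leftMulMatrix μ))⁰ K) :
            Submodule (endOrder (Algebra.leftMulMatrix μ)) K).spanFinrank :=
  ⟨fun ν hST ↦ by
      haveI := isFractionRing_endOrder (Algebra.leftMulMatrix ν)
      exact iSup_spanFinrank_coe_le_iSup_spanFinrank_coe_of_le μ hST,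
    ⟨μ, le_rfl, rfl⟩⟩

/-- **THEOREM 4.7, (v) ⟺ (vi) as one equality over the presentations `T = endOrder (M_ν) ⊇ S` of the over-orders:
`⨆_{T ∈ 𝒮} gens(T) = gens(S)`.** [cite: Marseglia2024CMType, §4 Thm. 4.7 ((v) ⟺ (vi)), p. 11] -/
theorem iSup_iSup_spanFinrank_coe_eq :
    ⨆ ν : {ν : Basis ι ℚ K // endOrder (Algebra.leftMulMatrix μ) ≤ endOrder (Algebra.leftMulMatrix ν)},
        ⨆ I' : {I' : FractionalIdeal (endOrder (Algebra.leftMulMatrix (ν : Basis ι ℚ K)))⁰ K // I' ≠ 0},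
          ((I' : FractionalIdeal (endOrder (Algebra.leftMulMatrix (ν : Basis ι ℚ K)))⁰ K) :
            Submodule (endOrder (Algebra.leftMulMatrix (ν : Basis ι ℚ K))) K).spanFinrank =
      ⨆ I : {I : FractionalIdeal (endOrder (Algebra.leftMulMatrix μ))⁰ K // I ≠ 0},
        ((I : FractionalIdeal (endOrder (Algebra.leftMulMatrix μ))⁰ K) :
          Submodule (endOrder (Algebra.leftMulMatrix μ)) K).spanFinrank := by
  haveI : Nonempty {ν : Basis ι ℚ K // endOrder (Algebra.leftMulMatrix μ) ≤ endOrder (Algebra.leftMulMatrix ν)} :=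
    ⟨⟨μ, le_rfl⟩⟩
  obtain ⟨hle, -⟩ := forall_iSup_spanFinrank_coe_le_and_exists_eq μ
  refine le_antisymm (ciSup_le fun ν ↦ hle ν.1 ν.2) ?_
  exact le_ciSup_of_le ⟨_, by rintro _ ⟨ν, rfl⟩; exact hle ν.1 ν.2⟩
    (⟨μ, le_rfl⟩ : {ν : Basis ι ℚ K // endOrder (Algebra.leftMulMatrix μ) ≤ endOrder (Algebra.leftMulMatrix ν)})
    le_rfl

/-! ## §3 THEOREM 4.7 (iv) ⟺ (vi): `gens(S) = max_{T ∈ 𝒮} max_𝔔 dim_{T/𝔔} 𝒪_K/𝔔𝒪_K` -/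

/-- **MARSEGLIA 2024 THEOREM 4.7, (iv) ⟺ (vi) «`max_{T ∈ 𝒮} max{dim_{T/𝔓} (𝒪_K/𝔓𝒪_K) : 𝔓 a prime of T} = d` ⟺
`gens(S) = d`» for EVERY non-maximal order `S = endOrder (M_μ)`**: for every over-order `T = endOrder (M_ν) ⊇ S`
and its maximal-order ideal `M'` (`↑M' = 𝒪_K`), `max_𝔔 dim_{T/𝔔} 𝒪_K/𝔔𝒪_K ≤ gens_T(𝒪_K) ≤ gens(T) ≤ gens(S)`,
with equality at `T = S` by COROLLARY 4.4 («Corollary 4.4 gives the equivalence of (iii) and (iv) […] (iv) and (v)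
are equivalent»). [cite: Marseglia2024CMType, §4 Thm. 4.7 ((iv) ⟺ (v) ⟺ (vi)) and proof, p. 11; §4 Cor. 4.4, p. 10] -/
theorem forall_iSup_finrank_quotient_smul_top_le_and_exists_eq
    {M : FractionalIdeal (endOrder (Algebra.leftMulMatrix μ))⁰ K}
    (hMO : (M : Set K) = (algebraMap (𝓞 K) K).range)
    (hS : ∃ a : 𝓞 K, (a : K) ∉ endOrder (Algebra.leftMulMatrix μ)) :
    (∀ ν : Basis ι ℚ K, endOrder (Algebra.leftMulMatrix μ) ≤ endOrder (Algebra.leftMulMatrix ν) →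
      ∀ M' : FractionalIdeal (endOrder (Algebra.leftMulMatrix ν))⁰ K,
        (M' : Set K) = (algebraMap (𝓞 K) K).range →
        ⨆ 𝔔 : MaximalSpectrum (endOrder (Algebra.leftMulMatrix ν)),
            Module.finrank (endOrder (Algebra.leftMulMatrix ν) ⧸ 𝔔.asIdeal)
              ((M' : Submodule (endOrder (Algebra.leftMulMatrix ν)) K) ⧸
                (𝔔.asIdeal • ⊤ : Submodule (endOrder (Algebra.leftMulMatrix ν))
                  (M' : Submodule (endOrder (Algebra.leftMulMatrix ν)) K))) ≤
          ⨆ I : {I : FractionalIdeal (endOrder (Algebra.leftMulMatrix μ))⁰ K // I ≠ 0},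
            ((I : FractionalIdeal (endOrder (Algebra.leftMulMatrix μ))⁰ K) :
              Submodule (endOrder (Algebra.leftMulMatrix μ)) K).spanFinrank) ∧
    ∃ ν : Basis ι ℚ K, endOrder (Algebra.leftMulMatrix μ) ≤ endOrder (Algebra.leftMulMatrix ν) ∧
      ∃ M' : FractionalIdeal (endOrder (Algebra.leftMulMatrix ν))⁰ K,
        (M' : Set K) = (algebraMap (𝓞 K) K).range ∧
        ⨆ 𝔔 : MaximalSpectrum (endOrder (Algebra.leftMulMatrix ν)),
            Module.finrank (endOrder (Algebra.leftMulMatrix ν) ⧸ 𝔔.asIdeal)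
              ((M' : Submodule (endOrder (Algebra.leftMulMatrix ν)) K) ⧸
                (𝔔.asIdeal • ⊤ : Submodule (endOrder (Algebra.leftMulMatrix ν))
                  (M' : Submodule (endOrder (Algebra.leftMulMatrix ν)) K))) =
          ⨆ I : {I : FractionalIdeal (endOrder (Algebra.leftMulMatrix μ))⁰ K // I ≠ 0},
            ((I : FractionalIdeal (endOrder (Algebra.leftMulMatrix μ))⁰ K) :
              Submodule (endOrder (Algebra.leftMulMatrix μ)) K).spanFinrank := by
  refine ⟨fun ν hST M' hMO' ↦ ?_, ⟨μ, le_rfl, M, hMO, ?_⟩⟩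
  · exact (iSup_finrank_quotient_smul_top_le_iSup_spanFinrank ν (ne_zero_of_coe_eq_range ν hMO')).trans
      (by
        haveI := isFractionRing_endOrder (Algebra.leftMulMatrix ν)
        exact iSup_spanFinrank_coe_le_iSup_spanFinrank_coe_of_le μ hST)
  · haveI := isFractionRing_endOrder (Algebra.leftMulMatrix μ)
    exact (iSup_spanFinrank_coe_eq_iSup_finrank_quotient_smul_top μ hMO hS).symm

/-! ## §4 THEOREM 4.7 (ii) ⟺ (vi): `gens(S) = max_{T ∈ 𝒮} max_𝔔 dim_{T/𝔔} (𝔔:𝔔)/𝔔(𝔔:𝔔)` -/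

/-- **MARSEGLIA 2024 THEOREM 4.7, (ii) ⟺ (vi) «`max_{T ∈ 𝒮} max{dim_{T/𝔓} ((𝔓:𝔓)/𝔓(𝔓:𝔓)) : 𝔓 a prime of T} = d`
⟺ `gens(S) = d`» for EVERY non-maximal order `S = endOrder (M_μ)`**: for every over-order `T = endOrder (M_ν) ⊇ S`,
`max_𝔔 dim_{T/𝔔} (𝔔:𝔔)/𝔔(𝔔:𝔔) ≤ gens(S)` (each term is `≤ gens_T((𝔔:𝔔)) ≤ gens(T) ≤ gens(S)`), with equality
at the over-order `T = S + 𝔭𝒪_K` of PROPOSITION 4.5, where `max_𝔔 dim (𝔔:𝔔)/𝔔(𝔔:𝔔) = type(T) + 1`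
(COROLLARY 3.6, `T ≠ 𝒪_K`) `= gens(S)` («by Corollary 3.6. This implies the equivalence of (i) and (ii)»).
[cite: Marseglia2024CMType, §4 Thm. 4.7 ((i) ⟺ (ii) ⟺ (vi)) and proof, p. 11; §3 Cor. 3.6, p. 9; §4 Prop. 4.5,
p. 10] -/
theorem forall_iSup_finrank_div_self_quotient_le_and_exists_eq
    {M : FractionalIdeal (endOrder (Algebra.leftMulMatrix μ))⁰ K}
    (hMO : (M : Set K) = (algebraMap (𝓞 K) K).range)
    (hS : ∃ a : 𝓞 K, (a : K) ∉ endOrder (Algebra.leftMulMatrix μ)) :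
    (∀ (ν : Basis ι ℚ K) [IsFractionRing (endOrder (Algebra.leftMulMatrix ν)) K],
      endOrder (Algebra.leftMulMatrix μ) ≤ endOrder (Algebra.leftMulMatrix ν) →
      ⨆ 𝔔 : MaximalSpectrum (endOrder (Algebra.leftMulMatrix ν)),
          Module.finrank (endOrder (Algebra.leftMulMatrix ν) ⧸ 𝔔.asIdeal)
            ((((𝔔.asIdeal : FractionalIdeal (endOrder (Algebra.leftMulMatrix ν))⁰ K) / 𝔔.asIdeal :
              FractionalIdeal (endOrder (Algebra.leftMulMatrix ν))⁰ K) :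
                Submodule (endOrder (Algebra.leftMulMatrix ν)) K) ⧸
              (𝔔.asIdeal • ⊤ : Submodule (endOrder (Algebra.leftMulMatrix ν))
                (((𝔔.asIdeal : FractionalIdeal (endOrder (Algebra.leftMulMatrix ν))⁰ K) / 𝔔.asIdeal :
                  FractionalIdeal (endOrder (Algebra.leftMulMatrix ν))⁰ K) :
                    Submodule (endOrder (Algebra.leftMulMatrix ν)) K))) ≤
        ⨆ I : {I : FractionalIdeal (endOrder (Algebra.leftMulMatrix μ))⁰ K // I ≠ 0},
          ((I : FractionalIdeal (endOrder (Algebra.leftMulMatrix μ))⁰ K) :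
            Submodule (endOrder (Algebra.leftMulMatrix μ)) K).spanFinrank) ∧
    ∃ ν : Basis ι ℚ K, endOrder (Algebra.leftMulMatrix μ) ≤ endOrder (Algebra.leftMulMatrix ν) ∧
      ∀ [IsFractionRing (endOrder (Algebra.leftMulMatrix ν)) K],
      ⨆ 𝔔 : MaximalSpectrum (endOrder (Algebra.leftMulMatrix ν)),
          Module.finrank (endOrder (Algebra.leftMulMatrix ν) ⧸ 𝔔.asIdeal)
            ((((𝔔.asIdeal : FractionalIdeal (endOrder (Algebra.leftMulMatrix ν))⁰ K) / 𝔔.asIdeal :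
              FractionalIdeal (endOrder (Algebra.leftMulMatrix ν))⁰ K) :
                Submodule (endOrder (Algebra.leftMulMatrix ν)) K) ⧸
              (𝔔.asIdeal • ⊤ : Submodule (endOrder (Algebra.leftMulMatrix ν))
                (((𝔔.asIdeal : FractionalIdeal (endOrder (Algebra.leftMulMatrix ν))⁰ K) / 𝔔.asIdeal :
                  FractionalIdeal (endOrder (Algebra.leftMulMatrix ν))⁰ K) :
                    Submodule (endOrder (Algebra.leftMulMatrix ν)) K))) =
        ⨆ I : {I : FractionalIdeal (endOrder (Algebra.leftMulMatrix μ))⁰ K // I ≠ 0},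
          ((I : FractionalIdeal (endOrder (Algebra.leftMulMatrix μ))⁰ K) :
            Submodule (endOrder (Algebra.leftMulMatrix μ)) K).spanFinrank := by
  refine ⟨fun ν _ hST ↦ ?_, ?_⟩
  · exact (iSup_finrank_div_self_quotient_le_iSup_spanFinrank ν).trans
      (iSup_spanFinrank_coe_le_iSup_spanFinrank_coe_of_le μ hST)
  · haveI := isFractionRing_endOrder (Algebra.leftMulMatrix μ)
    -- the prime `𝔭` of PROPOSITION 4.5 «In particular» and the over-order `T = S + 𝔭𝒪_K = endOrder (M_ν)`
    obtain ⟨𝔭, hu, h𝔭⟩ := exists_not_isUnit_forall_iSup_add_one_eq_iSup_spanFinrank μ hMO hS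
    obtain ⟨ν, hν⟩ := exists_basis_mem_endOrder_iff_exists_add μ hMO 𝔭.asIdeal
    haveI := 𝔭.isMaximal
    refine ⟨ν, endOrder_le_endOrder_of_mem_iff μ ν hν, ?_⟩
    intro hfr
    -- `T ≠ 𝒪_K` («Hence `𝔓` is not invertible»), so COROLLARY 3.6 applies to `T`
    obtain ⟨𝔓, h𝔓⟩ := exists_ideal_mem_iff_coe_mem μ ν hMO hν
    have hS' := exists_coe_not_mem_endOrder_of_not_isUnit μ ν hMO hν h𝔓 hu
    obtain ⟨T', -, hT'⟩ := exists_coe_eq_traceDual ν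
      (one_ne_zero' (FractionalIdeal (endOrder (Algebra.leftMulMatrix ν))⁰ K))
    rw [← iSup_spanFinrank_coe_div_self_eq_iSup_finrank_div_self_quotient ν hT',
      ← iSup_finrank_traceDual_quotient_add_one_eq_iSup_spanFinrank ν hT' hS']
    exact h𝔭 ν hν T' hT'

end OverordersMaxima

end CMTypeLattice

end Literature.NumberTheory.ComplexMultiplication
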